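import Mathlib
import HarnessLib
import Literature.Combinatorics.SimpleGraph.LasserreStableBound
import Literature.Combinatorics.SimpleGraph.LovaszThetaComplement
import Summits.PneNP.PneNP.Theses.RamseyUncertifiable
import Summits.PneNP.PneNP.Theorems.RamseyUncertifiableSosUncertaintyConditioningDefs
import Summits.PneNP.PneNP.Theorems.RamseyUncertifiableSosUncertaintyConditioning
import Summits.PneNP.PneNP.Theorems.RamseyUncertifiableSosUncertaintyConditioningCertificate

/-!
# Route `RamseyUncertifiable`, item `SosUncertainty` (stmt-PneNP-9815) — conditioning certificates
# obey an uncertainty principle with exponent `1/s` (no fixed-level conditioning kill of `UP_s`)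

**Theorem (`condCert_uncertainty`).** For every `s ≥ 1` and every finite nonempty graph `H` on `n`
vertices,

  `n^{1/s} − (s − 1) ≤ condCert H s · condCert Hᶜ s`.

So the natural level-`s` certificate of the crux notes (iterated conditioning down to Lovász's `ϑ`,
valid by `lasserreStableBound_le_condCert`) can never exhibit a graph with
`las_s(G) · las_s(Gᶜ) < n^{1/s} − s + 1`: a refutation of `UP_s` at a fixed level needs certificates
beyond conditioning-plus-`ϑ` on BOTH sides. At `s = 1` the statement is Lovász's `ϑ(H)ϑ(Hᶜ) ≥ n`;
at `s = 2` it is the refuter's `levelTwoCertificate_uncertainty` (`√n − 1`, Disproof (h)); the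
exponent `1/s` matches the bounded-`α` families (`α ≤ s ⇒ las_s = α`, product `≈ n^{Θ(1/s)}`), i.e.
the conjectured true order `δ_s = Θ(1/s)` of the crux.

Proof (induction on `s`; the step `s → s + 1` for `H` on `n` vertices): let `m` be the largest
ESCAPE SET `|N̄(u) ∩ N(x)|` over pairs `(u, x)`, attained at `(u₀, x₀)`, and put `θ = n^{s/(s+1)}`.
* If `m + 1 ≥ θ`: `X = N̄(u₀) ∩ N(x₀)` lies below the non-neighbourhood of `u₀` in `H` and below the
  non-neighbourhood of `x₀` in `Hᶜ`, so `1 + condCert (H[X]) s ≤ condCert H (s+1)` and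
  `1 + condCert (H[X]ᶜ) s ≤ condCert Hᶜ (s+1)` (`one_add_condCert_induce_le`); the level-`s`
  statement for `H[X]` (`m` vertices) gives product `≥ m^{1/s} − (s−1) ≥ n^{1/(s+1)} − s`
  (`(m+1)^{1/s} ≤ m^{1/s} + 1`, Mathlib `Real.rpow_add_le_add_rpow`).
* If `m + 1 < θ`: every link complement `H[N̄ x]` and every `Hᶜ[N x]` has maximum degree `≤ m`
  (their neighbourhoods ARE escape sets), so by Caro–Wei (`card_le_mul_indepNum`, greedy) their
  stability numbers are `≥ |N̄ x|/(m+1)`, `≥ |N x|/(m+1)`; with `condCert ≥ 1 + α(link)` on both sides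
  and `|N̄ x| + |N x| = n − 1` the product is `≥ 1 + (n−1)/(m+1) ≥ 1 + (n−1)/θ ≥ n^{1/(s+1)}`.

Also here: the weak Caro–Wei bound `exists_indepSet_card_le` / `card_le_mul_indepNum`
(`|W| ≤ (Δ+1) α`, greedy), the escape-set degree bounds, and the two real-analysis steps.
[folklore; the case `s = 2` is refuter-cdisprove-stmt-PneNP-9815 Disproof (h)]
-/

-- the Theorems namespace `Summit.PneNP.PneNP.Theorems` is prescribed by the tree layout
set_option linter.dupNamespace false

noncomputable section

namespace Summit.PneNP.PneNP.Theorems.SosUncertainty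

open Literature.Combinatorics.SimpleGraph Finset Matrix

/-! ### Caro–Wei (greedy, weak form) -/

section CaroWei

variable {W : Type} [Fintype W] [DecidableEq W] (F : SimpleGraph W) [DecidableRel F.Adj]

/-- Greedy independent sets: inside any vertex set `X` of a graph with all degrees `≤ m` there is a
stable set `I ⊆ X` with `|X| ≤ (m + 1)|I|`. [folklore: Caro–Wei / Turán, weak form] -/
theorem exists_indepSet_card_le {m : ℕ} (hdeg : ∀ w, F.degree w ≤ m) (X : Finset W) :
    ∃ I : Finset W, I ⊆ X ∧ F.IsIndepSet (I : Set W) ∧ X.card ≤ (m + 1) * I.card := by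
  induction X using Finset.strongInduction with
  | H X ih =>
    rcases X.eq_empty_or_nonempty with rfl | ⟨v, hv⟩
    · exact ⟨∅, subset_rfl, by simp, by simp⟩
    · set X' : Finset W := (X.erase v).filter (fun w => ¬ F.Adj v w) with hX'
      have hX'sub : X' ⊆ X := (filter_subset _ _).trans (erase_subset _ _)
      have hvX' : v ∉ X' := fun h => by
        have := (mem_filter.1 h).1
        exact (notMem_erase v X) this
      have hss : X' ⊂ X := Finset.ssubset_iff_subset_ne.2 ⟨hX'sub, fun h => hvX' (h ▸ hv)⟩
      obtain ⟨I', hI'X', hI'ind, hcard⟩ := ih X' hss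
      refine ⟨insert v I', ?_, ?_, ?_⟩
      · exact insert_subset hv (hI'X'.trans hX'sub)
      · intro a ha b hb hab
        rw [mem_coe, mem_insert] at ha hb
        have hnadj : ∀ w ∈ I', ¬ F.Adj v w := fun w hw => (mem_filter.1 (hI'X' hw)).2
        rcases ha with rfl | ha <;> rcases hb with rfl | hb
        · exact absurd rfl hab
        · exact hnadj b hb
        · exact fun h => hnadj a ha h.symm
        · exact hI'ind (mem_coe.2 ha) (mem_coe.2 hb) hab
      · have hvI' : v ∉ I' := fun h => hvX' (hI'X' h)
        rw [card_insert_of_notMem hvI']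
        -- `X ⊆ X' ∪ insert v N(v)`
        have hcov : X ⊆ X' ∪ insert v (F.neighborFinset v) := by
          intro w hw
          rw [mem_union, mem_insert, SimpleGraph.mem_neighborFinset]
          by_cases hwv : w = v
          · exact Or.inr (Or.inl hwv)
          · by_cases hadj : F.Adj v w
            · exact Or.inr (Or.inr hadj)
            · exact Or.inl (mem_filter.2 ⟨mem_erase.2 ⟨hwv, hw⟩, hadj⟩)
        have h1 := (card_le_card hcov).trans (card_union_le _ _)
        have h2 : (insert v (F.neighborFinset v)).card ≤ m + 1 :=
          (card_insert_le _ _).trans (by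
            rw [SimpleGraph.card_neighborFinset_eq_degree]; exact Nat.succ_le_succ (hdeg v))
        calc X.card ≤ X'.card + (insert v (F.neighborFinset v)).card := h1
          _ ≤ (m + 1) * I'.card + (m + 1) := add_le_add hcard h2
          _ = (m + 1) * (I'.card + 1) := by ring

/-- **Caro–Wei, weak form**: if all degrees are `≤ m` then `|W| ≤ (m + 1) α(F)`. [folklore] -/
theorem card_le_mul_indepNum {m : ℕ} (hdeg : ∀ w, F.degree w ≤ m) :
    Fintype.card W ≤ (m + 1) * F.indepNum := by
  obtain ⟨I, -, hind, hcard⟩ := exists_indepSet_card_le F hdeg univ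
  rw [card_univ] at hcard
  exact hcard.trans (Nat.mul_le_mul_left _ hind.card_le_indepNum)

end CaroWei

/-! ### Escape sets, and the uncertainty principle for conditioning certificates -/

section Uncertainty

variable {V : Type} [Fintype V] [DecidableEq V] (G : SimpleGraph V) [DecidableRel G.Adj]

/-- Degrees inside the link complement `G[N̄ x]` are escape-set sizes `|N̄(x) ∩ N(y)|`. -/
theorem degree_induce_compl_neighborSet_le (x : V) (y : Gᶜ.neighborSet x) :
    (G.induce (Gᶜ.neighborSet x)).degree y ≤ (Gᶜ.neighborFinset x ∩ G.neighborFinset y.1).card := by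
  rw [← SimpleGraph.card_neighborFinset_eq_degree]
  have h : ((G.induce (Gᶜ.neighborSet x)).neighborFinset y).map (Function.Embedding.subtype _) ⊆
      Gᶜ.neighborFinset x ∩ G.neighborFinset y.1 := by
    intro z hz
    simp only [Finset.mem_map, SimpleGraph.mem_neighborFinset, Function.Embedding.coe_subtype] at hz
    obtain ⟨a, ha, rfl⟩ := hz
    rw [mem_inter, SimpleGraph.mem_neighborFinset, SimpleGraph.mem_neighborFinset]
    exact ⟨a.2, ha⟩
  exact (Finset.card_map _).symm.le.trans (Finset.card_le_card h)

/-- Degrees inside `Gᶜ[N x]` are escape-set sizes `|N̄(z) ∩ N(x)|`. -/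
theorem degree_compl_induce_neighborSet_le (x : V) (z : G.neighborSet x) :
    (Gᶜ.induce (G.neighborSet x)).degree z ≤ (Gᶜ.neighborFinset z.1 ∩ G.neighborFinset x).card := by
  rw [← SimpleGraph.card_neighborFinset_eq_degree]
  have h : ((Gᶜ.induce (G.neighborSet x)).neighborFinset z).map (Function.Embedding.subtype _) ⊆
      Gᶜ.neighborFinset z.1 ∩ G.neighborFinset x := by
    intro w hw
    simp only [Finset.mem_map, SimpleGraph.mem_neighborFinset, Function.Embedding.coe_subtype] at hw
    obtain ⟨a, ha, rfl⟩ := hw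
    rw [mem_inter, SimpleGraph.mem_neighborFinset, SimpleGraph.mem_neighborFinset]
    exact ⟨ha, a.2⟩
  exact (Finset.card_map _).symm.le.trans (Finset.card_le_card h)

/-- `|N̄(x)| + |N(x)| = n − 1`. -/
theorem card_compl_neighborSet_add (x : V) :
    (Fintype.card (Gᶜ.neighborSet x) : ℝ) + (Fintype.card (G.neighborSet x) : ℝ) =
      (Fintype.card V : ℝ) - 1 := by
  rw [SimpleGraph.card_neighborSet_eq_degree, SimpleGraph.card_neighborSet_eq_degree,
    SimpleGraph.degree_compl]
  have h1 : G.degree x ≤ Fintype.card V - 1 := Nat.le_sub_one_of_lt (G.degree_lt_card_verts x)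
  have hn : 1 ≤ Fintype.card V := Fintype.card_pos_iff.2 ⟨x⟩
  rw [Nat.cast_sub h1, Nat.cast_sub hn, Nat.cast_one]
  ring

/-- Real-analysis step: `n^q ≤ 1 + (n − 1)/n^p` for `n ≥ 1`, `p ≥ 0`, `p + q = 1`. -/
theorem rpow_le_one_add_div {n : ℝ} (hn : 1 ≤ n) {p q : ℝ} (hp : 0 ≤ p) (hpq : p + q = 1) :
    n ^ q ≤ 1 + (n - 1) / n ^ p := by
  have hn0 : 0 < n := one_pos.trans_le hn
  have hnp : 1 ≤ n ^ p := Real.one_le_rpow hn hp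
  have hpos : 0 < n ^ p := by positivity
  have hq : q = 1 - p := by linarith
  rw [hq, Real.rpow_sub hn0, Real.rpow_one, div_le_iff₀ hpos, add_mul, div_mul_cancel₀ _ hpos.ne',
    one_mul]
  linarith

/-- Real-analysis step: if `n^p ≤ m + 1` (`m ≥ 0`, `0 < s`, `p/s = q`... stated with `p * r = q`,
`0 ≤ r ≤ 1`) then `n^q ≤ m^r + 1`. -/
theorem rpow_le_rpow_add_one {n m p r q : ℝ} (hn : 0 ≤ n) (hm : 0 ≤ m) (hr0 : 0 ≤ r) (hr1 : r ≤ 1)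
    (hprq : p * r = q) (h : n ^ p ≤ m + 1) : n ^ q ≤ m ^ r + 1 := by
  have h1 : (n ^ p) ^ r ≤ (m + 1) ^ r := Real.rpow_le_rpow (Real.rpow_nonneg hn _) h hr0
  rw [← Real.rpow_mul hn, hprq] at h1
  have h2 : (m + 1) ^ r ≤ m ^ r + (1 : ℝ) ^ r := Real.rpow_add_le_add_rpow hm zero_le_one hr0 hr1
  rw [Real.one_rpow] at h2
  exact h1.trans h2

/-- **The uncertainty principle for conditioning certificates (all levels).** For every `s ≥ 1` and
every finite nonempty graph `H` on `n` vertices,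
`n^{1/s} − (s − 1) ≤ condCert H s · condCert Hᶜ s`.
At `s = 1` this is Lovász's `ϑ(H) ϑ(Hᶜ) ≥ n`; the induction step picks the largest "escape set"
`X = N̄(u₀) ∩ N(x₀)` (size `m`): if `m + 1 ≥ n^{s/(s+1)}`, both certificates condition into `H[X]`
(`1 + condCert (H[X]) s ≤ condCert H (s+1)`, same for complements) and the level-`s` statement for
`H[X]` applies; otherwise every link complement `H[N̄ x]` and every `Hᶜ[N x]` has maximum degree
`≤ m`, so by Caro–Wei their stability numbers are `≥ |N̄ x|/(m+1)`, `≥ |N x|/(m+1)`, and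
`(1 + |N̄ x|/(m+1))(1 + |N x|/(m+1)) ≥ 1 + (n−1)/(m+1) ≥ n^{1/(s+1)}`. -/
theorem condCert_uncertainty :
    ∀ (s : ℕ), 1 ≤ s → ∀ {W : Type} [Fintype W] [DecidableEq W] [Nonempty W] (H : SimpleGraph W)
      [DecidableRel H.Adj],
      (Fintype.card W : ℝ) ^ (1 / (s : ℝ)) - ((s : ℝ) - 1) ≤ condCert H s * condCert Hᶜ s := by
  intro s hs
  induction s, hs using Nat.le_induction with
  | base =>
    intro W _ _ _ H _
    simp only [Nat.cast_one, div_one, Real.rpow_one, sub_self, sub_zero]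
    have hLov := card_le_lovaszTheta_mul_lovaszTheta_compl H
    refine hLov.trans (mul_le_mul (lovaszTheta_le_condCert_one H) (lovaszTheta_le_condCert_one Hᶜ)
      (lovaszTheta_nonneg _) (condCert_nonneg H 1))
  | succ s hs ih =>
    intro W _ _ _ H _
    -- notation
    set n : ℝ := (Fintype.card W : ℝ) with hn
    have hn1 : 1 ≤ n := by rw [hn]; exact_mod_cast Fintype.card_pos
    have hn0 : 0 ≤ n := zero_le_one.trans hn1
    have hs0 : (0 : ℝ) < s := by exact_mod_cast hs
    set p : ℝ := (s : ℝ) / ((s : ℝ) + 1) with hp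
    set q : ℝ := 1 / ((s : ℝ) + 1) with hq
    have hp0 : 0 ≤ p := by rw [hp]; positivity
    have hpq : p + q = 1 := by rw [hp, hq]; field_simp
    have hpq' : p * (1 / (s : ℝ)) = q := by rw [hp, hq]; field_simp
    have hgoal : (Fintype.card W : ℝ) ^ (1 / ((s + 1 : ℕ) : ℝ)) - (((s + 1 : ℕ) : ℝ) - 1) = n ^ q - s := by
      rw [hq, hn]; push_cast; ring_nf
    rw [hgoal]
    -- lower bounds available at level `s + 1`
    have hcs : ∀ (K : SimpleGraph W) [DecidableRel K.Adj], (s : ℝ) ≤ condCert K (s + 1) := by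
      intro K _
      have h := sub_one_le_condCert K (s + 1)
      rwa [Nat.add_sub_cancel] at h
    -- the largest escape set
    obtain ⟨⟨u₀, x₀⟩, -, hmax⟩ := Finset.exists_max_image (univ : Finset (W × W))
      (fun e => (Hᶜ.neighborFinset e.1 ∩ H.neighborFinset e.2).card)
      ⟨⟨Classical.arbitrary W, Classical.arbitrary W⟩, mem_univ _⟩
    set m : ℕ := (Hᶜ.neighborFinset u₀ ∩ H.neighborFinset x₀).card with hm
    have hmall : ∀ u x : W, (Hᶜ.neighborFinset u ∩ H.neighborFinset x).card ≤ m :=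
      fun u x => hmax ⟨u, x⟩ (mem_univ _)
    have hm0 : (0 : ℝ) ≤ m := Nat.cast_nonneg _
    by_cases hcase : n ^ p ≤ (m : ℝ) + 1
    · -- Case 1: a large escape set `X = N̄(u₀) ∩ N(x₀)`
      rcases Nat.eq_zero_or_pos m with hmz | hmpos
      · -- `m = 0` forces `n = 1`
        have hnp1 : n ^ p ≤ 1 := by rw [hmz, Nat.cast_zero, zero_add] at hcase; exact hcase
        have hn_eq : n = 1 := by
          by_contra hne
          have hlt : 1 < n := lt_of_le_of_ne hn1 (Ne.symm hne)
          have hp_pos : 0 < p := by rw [hp]; positivity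
          have := Real.one_lt_rpow hlt hp_pos
          linarith
        rw [hn_eq, Real.one_rpow]
        have h1 := hcs H
        have h2 := hcs Hᶜ
        have hs1 : (1 : ℝ) ≤ s := by exact_mod_cast hs
        nlinarith
      · -- `m ≥ 1`: condition into `H[X]`
        set X : Set W := {y : W | Hᶜ.Adj u₀ y ∧ H.Adj x₀ y} with hXdef
        have hXu : X ⊆ Hᶜ.neighborSet u₀ := fun y hy => hy.1
        have hXx : X ⊆ Hᶜᶜ.neighborSet x₀ := fun y hy => by
          show Hᶜᶜ.Adj x₀ y
          rw [compl_compl]; exact hy.2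
        have hcardX : Fintype.card X = m := by
          rw [hm]
          refine Fintype.card_of_subtype _ fun y => ?_
          simp [hXdef, SimpleGraph.mem_neighborFinset, SimpleGraph.compl_adj]
        haveI : Nonempty X := by
          rw [← Fintype.card_pos_iff, hcardX]; exact hmpos
        have hIH := ih (H.induce X)
        rw [hcardX] at hIH
        have h1 := one_add_condCert_induce_le H X u₀ hXu hs
        have h2 := one_add_condCert_induce_le Hᶜ X x₀ hXx hs
        have h3 : condCert (Hᶜ.induce X) s = condCert (H.induce X)ᶜ s :=
          condCert_congr (compl_induce_eq H X).symm s
        rw [h3] at h2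
        set A := condCert (H.induce X) s with hA
        set B := condCert (H.induce X)ᶜ s with hB
        have hA0 : 0 ≤ A := condCert_nonneg _ s
        have hB0 : 0 ≤ B := condCert_nonneg _ s
        -- `n^q ≤ m^{1/s} + 1`
        have hnq : n ^ q ≤ (m : ℝ) ^ (1 / (s : ℝ)) + 1 :=
          rpow_le_rpow_add_one hn0 hm0 (by positivity)
            (by rw [div_le_one hs0]; exact_mod_cast hs) hpq' hcase
        have hprod : (1 + A) * (1 + B) ≤ condCert H (s + 1) * condCert Hᶜ (s + 1) :=
          mul_le_mul h1 h2 (by positivity) (condCert_nonneg H (s + 1))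
        nlinarith [mul_nonneg hA0 hB0]
    · -- Case 2: all escape sets are small; Caro–Wei in both links at `x₀`
      push Not at hcase
      -- the two links at `x₀`
      have hdeg1 : ∀ y : Hᶜ.neighborSet x₀, (H.induce (Hᶜ.neighborSet x₀)).degree y ≤ m :=
        fun y => (degree_induce_compl_neighborSet_le H x₀ y).trans (hmall x₀ y.1)
      have hdeg2 : ∀ z : H.neighborSet x₀, (Hᶜ.induce (H.neighborSet x₀)).degree z ≤ m :=
        fun z => (degree_compl_induce_neighborSet_le H x₀ z).trans (hmall z.1 x₀)
      have hcw1 := card_le_mul_indepNum (H.induce (Hᶜ.neighborSet x₀)) hdeg1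
      have hcw2 := card_le_mul_indepNum (Hᶜ.induce (H.neighborSet x₀)) hdeg2
      have hk1 := one_add_condCert_induce_le H (Hᶜ.neighborSet x₀) x₀ subset_rfl hs
      have hk2 := one_add_condCert_induce_le Hᶜ (H.neighborSet x₀) x₀
        (fun y hy => by show Hᶜᶜ.Adj x₀ y; rw [compl_compl]; exact hy) hs
      have hα1 := indepNum_le_condCert (H.induce (Hᶜ.neighborSet x₀)) s
      have hα2 := indepNum_le_condCert (Hᶜ.induce (H.neighborSet x₀)) s
      set a : ℝ := (Fintype.card (Hᶜ.neighborSet x₀) : ℝ) with ha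
      set b : ℝ := (Fintype.card (H.neighborSet x₀) : ℝ) with hb
      have hab : a + b = n - 1 := by rw [ha, hb, hn]; exact card_compl_neighborSet_add H x₀
      have hm1 : (0 : ℝ) < m + 1 := by positivity
      have ha' : a ≤ (m + 1) * ((H.induce (Hᶜ.neighborSet x₀)).indepNum : ℝ) := by
        rw [ha]; exact_mod_cast hcw1
      have hb' : b ≤ (m + 1) * ((Hᶜ.induce (H.neighborSet x₀)).indepNum : ℝ) := by
        rw [hb]; exact_mod_cast hcw2
      -- `condCert H (s+1) ≥ 1 + a/(m+1)`, `condCert Hᶜ (s+1) ≥ 1 + b/(m+1)`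
      have hc1 : 1 + a / (m + 1) ≤ condCert H (s + 1) := by
        have : a / (m + 1) ≤ ((H.induce (Hᶜ.neighborSet x₀)).indepNum : ℝ) := by
          rw [div_le_iff₀ hm1]; linarith
        linarith
      have hc2 : 1 + b / (m + 1) ≤ condCert Hᶜ (s + 1) := by
        have : b / (m + 1) ≤ ((Hᶜ.induce (H.neighborSet x₀)).indepNum : ℝ) := by
          rw [div_le_iff₀ hm1]; linarith
        linarith
      have ha0 : 0 ≤ a := Nat.cast_nonneg _
      have hb0 : 0 ≤ b := Nat.cast_nonneg _
      have hprod : (1 + a / (m + 1)) * (1 + b / (m + 1)) ≤ condCert H (s + 1) * condCert Hᶜ (s + 1) :=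
        mul_le_mul hc1 hc2 (by positivity) ((by positivity : (0 : ℝ) ≤ 1 + a / (m + 1)).trans hc1)
      have hstep1 : 1 + (n - 1) / (m + 1) ≤ (1 + a / (m + 1)) * (1 + b / (m + 1)) := by
        rw [← hab, add_div]
        nlinarith [div_nonneg ha0 hm1.le, div_nonneg hb0 hm1.le]
      have hstep2 : 1 + (n - 1) / n ^ p ≤ 1 + (n - 1) / (m + 1) := by
        have hnp : 0 < n ^ p := Real.rpow_pos_of_pos (one_pos.trans_le hn1) _
        have : (n - 1) / n ^ p ≤ (n - 1) / (m + 1) :=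
          div_le_div_of_nonneg_left (by linarith) hm1 hcase.le
        linarith
      have hstep3 : n ^ q ≤ 1 + (n - 1) / n ^ p := rpow_le_one_add_div hn1 hp0 hpq
      have hs0' : (0 : ℝ) ≤ s := hs0.le
      linarith

end Uncertainty

end Summit.PneNP.PneNP.Theorems.SosUncertainty

end
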